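import Mathlib
import Literature.AlgebraicGeometry.Resolution.LocalBlowup
import HarnessLib

/-!
# Route `RadicialJung`, crux `CleanModels` (stmt-15917), stub `stub_cleanLU3DefectNonDiscrete`, sub-line (C-div): GLUE 1 — the best
# `v₁`-approximation data INSIDE the frame ring

Line `Sketch` rev 24 of crux stmt-ResolutionOfSingularities-15917; lead `res-B-lead-1` g4 (workfile `Lines/Sketch_Cdiv_assembly.lean` v2,
piece GLUE 1).  OURS; nothing here proves resolution in characteristic `p`.

Setting: `R ⊆ O₁` a subring of the field `K` with `O₁ ⊆ locAtCentre R O₁` (the divisorial coarsening IS the local ring of the model at its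
centre — the frame of ✓ `exists_frame_of_coarsening`), `t ∈ R` a PRIME element with `v₁ t < 1` (the regular parameter cutting out the centre).
Primality of `t` alone gives the valuation theory of `O₁` in terms of `R`: an element of `R` not divisible by `t` is an `O₁`-unit
(`valuation_eq_one_of_not_dvd` — if `v₁ e < 1`, either `e/t` or `t/e` lies in `O₁ ⊆ R_{centre}`, and cross-multiplying contradicts
`t ∤ e`); hence every nonzero `r ∈ R` is `t^n · (O₁-unit of R)` (`exists_eq_pow_mul_of_prime`, `R` Noetherian), every nonzero element of `O₁`
has value a power of `v₁ t` (`exists_valuation_eq_pow`), `v₁ t` bounds every value `< 1` and the values are archimedean with respect to it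
(`valuation_le_of_lt_one`, `exists_pow_le_valuation` — the two hypotheses of ✓ `exists_best_pthPowerApprox_of_derivation`), and GLUE 1
proper (`exists_bestApprox_data_in_frame`): from a best `v₁`-approximation `a` of `g₀ ∈ R` in the INERT branch of ✓ `bestApprox_dichotomy`
one gets `w, a', u ∈ R`, `m : ℕ` with `v₁ w = v₁ u = 1`, `w^p g₀ - a'^p = t^{pm} · u` and `u` residually not a `p`-th power — the remainder
and the residual unit now live in the frame ring `R`, ready for the residue map `R ↠ R/(t)`.
-/

noncomputable section

set_option linter.dupNamespace false -- mandated namespace of this single-conjunct summit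

open IsLocalRing
open Literature.AlgebraicGeometry.Resolution

namespace Summit.ResolutionOfSingularities.ResolutionOfSingularities.Theorems.RadicialJung.CleanModels

variable {K : Type} [Field K]

/-- **Elements of the frame ring prime to `t` are `O₁`-units**: `R ⊆ O₁ ⊆ locAtCentre R O₁`, `t ∈ R` prime with `v₁ t < 1`, `e ∈ R`,
`t ∤ e` ⟹ `v₁ e = 1`. [folklore] -/
theorem valuation_eq_one_of_not_dvd (O₁ : ValuationSubring K) (R : Subring K) (hRO₁ : R ≤ O₁.toSubring)
    (hloc : O₁.toSubring ≤ locAtCentre R O₁) (t : R) (ht : Prime t) (hvt : O₁.valuation (t : K) < 1)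
    (e : R) (he : ¬ t ∣ e) : O₁.valuation (e : K) = 1 := by
  have hvle : ∀ r : R, O₁.valuation (r : K) ≤ 1 := fun r => (O₁.valuation_le_one_iff _).mpr (hRO₁ r.2)
  by_contra hne
  have hlt : O₁.valuation (e : K) < 1 := lt_of_le_of_ne (hvle e) hne
  have he0 : (e : K) ≠ 0 := by
    intro h
    exact he (by rw [show e = 0 from Subtype.ext h]; exact dvd_zero _)
  have ht0 : (t : K) ≠ 0 := fun h => ht.ne_zero (Subtype.ext h)
  rcases O₁.mem_or_inv_mem ((e : K) / (t : K)) with h | h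
  · -- `e/t = y/z`, `v₁ z = 1`: `e z = t y`, so `t ∣ e z`, hence `t ∣ z` and `v₁ z < 1`
    obtain ⟨y, hy, z, hz, hvz, hyz⟩ := (mem_locAtCentre_iff (B := R) (O := O₁)).mp (hloc h)
    have hz0 : z ≠ 0 := ne_zero_of_valuation_eq_one hvz
    have hrel : e * ⟨z, hz⟩ = t * ⟨y, hy⟩ := by
      apply Subtype.ext
      change (e : K) * z = (t : K) * y
      rw [div_eq_div_iff ht0 hz0] at hyz
      exact hyz.trans (mul_comm _ _)
    have hdvd : t ∣ e * ⟨z, hz⟩ := ⟨⟨y, hy⟩, hrel⟩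
    rcases ht.dvd_or_dvd hdvd with h1 | ⟨c, hc⟩
    · exact he h1
    · have hzv : O₁.valuation z = O₁.valuation (t : K) * O₁.valuation ((c : R) : K) := by
        have := congrArg (fun r : R => (r : K)) hc
        simp only [Subring.coe_mul] at this
        rw [this, map_mul]
      have hlt' : O₁.valuation (t : K) * O₁.valuation ((c : R) : K) < 1 * 1 :=
        mul_lt_mul_of_lt_of_le_of_nonneg_of_pos hvt (hvle c) zero_le zero_lt_one
      rw [mul_one, ← hzv, hvz] at hlt'
      exact lt_irrefl _ hlt'
  · -- `t/e = y/z`, `v₁ z = 1`: `t z = e y`, so `t ∣ y`, `z = e y'`, and `v₁ z < 1`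
    rw [inv_div] at h
    obtain ⟨y, hy, z, hz, hvz, hyz⟩ := (mem_locAtCentre_iff (B := R) (O := O₁)).mp (hloc h)
    have hz0 : z ≠ 0 := ne_zero_of_valuation_eq_one hvz
    have hrel : t * ⟨z, hz⟩ = e * ⟨y, hy⟩ := by
      apply Subtype.ext
      change (t : K) * z = (e : K) * y
      rw [div_eq_div_iff he0 hz0] at hyz
      exact hyz.trans (mul_comm _ _)
    have hdvd : t ∣ e * ⟨y, hy⟩ := ⟨⟨z, hz⟩, hrel.symm⟩
    rcases ht.dvd_or_dvd hdvd with h1 | ⟨c, hc⟩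
    · exact he h1
    · -- `t z = e (t c)`, cancel `t`
      have hzc : (⟨z, hz⟩ : R) = e * c := by
        have h2 : t * ⟨z, hz⟩ = t * (e * c) := by rw [hrel, hc]; ring
        exact mul_left_cancel₀ ht.ne_zero h2
      have hzv : O₁.valuation z = O₁.valuation (e : K) * O₁.valuation ((c : R) : K) := by
        have := congrArg (fun r : R => (r : K)) hzc
        simp only [Subring.coe_mul] at this
        change z = _ at this
        rw [this, map_mul]
      have hlt' : O₁.valuation (e : K) * O₁.valuation ((c : R) : K) < 1 * 1 :=
        mul_lt_mul_of_lt_of_le_of_nonneg_of_pos hlt (hvle c) zero_le zero_lt_one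
      rw [mul_one, ← hzv, hvz] at hlt'
      exact lt_irrefl _ hlt'

/-- **`t`-adic factorisation in the frame ring**: with the hypotheses of `valuation_eq_one_of_not_dvd` and `R` Noetherian, every
nonzero `r ∈ R` is `t^n · e` with `e ∈ R` an `O₁`-unit. [folklore] -/
theorem exists_eq_pow_mul_of_prime (O₁ : ValuationSubring K) (R : Subring K) (hRO₁ : R ≤ O₁.toSubring)
    (hloc : O₁.toSubring ≤ locAtCentre R O₁) [IsNoetherianRing R] (t : R) (ht : Prime t)
    (hvt : O₁.valuation (t : K) < 1) (r : R) (hr : r ≠ 0) :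
    ∃ (n : ℕ) (e : R), O₁.valuation (e : K) = 1 ∧ r = t ^ n * e := by
  obtain ⟨n, e, hnd, hre⟩ := WfDvdMonoid.max_power_factor' hr ht.not_unit
  exact ⟨n, e, valuation_eq_one_of_not_dvd O₁ R hRO₁ hloc t ht hvt e hnd, hre⟩

/-- **Values of `O₁` are powers of `v₁ t`**: every nonzero `x ∈ O₁` has `v₁ x = (v₁ t)^n` for some `n`. [folklore] -/
theorem exists_valuation_eq_pow (O₁ : ValuationSubring K) (R : Subring K) (hRO₁ : R ≤ O₁.toSubring)
    (hloc : O₁.toSubring ≤ locAtCentre R O₁) [IsNoetherianRing R] (t : R) (ht : Prime t)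
    (hvt : O₁.valuation (t : K) < 1) (x : K) (hx : x ∈ O₁) (hx0 : x ≠ 0) :
    ∃ n : ℕ, O₁.valuation x = O₁.valuation (t : K) ^ n := by
  obtain ⟨y, hy, z, hz, hvz, hyz⟩ := (mem_locAtCentre_iff (B := R) (O := O₁)).mp (hloc hx)
  have hy0 : (⟨y, hy⟩ : R) ≠ 0 := by
    intro h
    have : y = 0 := congrArg Subtype.val h
    rw [this, zero_div] at hyz
    exact hx0 hyz
  obtain ⟨n, e, hve, hye⟩ := exists_eq_pow_mul_of_prime O₁ R hRO₁ hloc t ht hvt ⟨y, hy⟩ hy0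
  refine ⟨n, ?_⟩
  have hy' : y = (t : K) ^ n * (e : K) := by
    have := congrArg (fun r : R => (r : K)) hye
    simpa using this
  rw [hyz, map_div₀, hvz, div_one, hy', map_mul, map_pow, hve, mul_one]

/-- **`v₁ t` bounds every value below `1`** (first hypothesis `hπ` of ✓ `exists_best_pthPowerApprox_of_derivation`, with `π = t`). [folklore] -/
theorem valuation_le_of_lt_one (O₁ : ValuationSubring K) (R : Subring K) (hRO₁ : R ≤ O₁.toSubring)
    (hloc : O₁.toSubring ≤ locAtCentre R O₁) [IsNoetherianRing R] (t : R) (ht : Prime t)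
    (hvt : O₁.valuation (t : K) < 1) (x : K) (hx : O₁.valuation x < 1) :
    O₁.valuation x ≤ O₁.valuation (t : K) := by
  by_cases hx0 : x = 0
  · rw [hx0, map_zero]; exact zero_le
  have hxO : x ∈ O₁ := (O₁.valuation_le_one_iff _).mp hx.le
  obtain ⟨n, hn⟩ := exists_valuation_eq_pow O₁ R hRO₁ hloc t ht hvt x hxO hx0
  rw [hn] at hx ⊢
  rcases n with _ | n
  · rw [pow_zero] at hx; exact absurd hx (lt_irrefl _)
  · have hpow : O₁.valuation (t : K) ^ n ≤ 1 := pow_le_one₀ zero_le hvt.le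
    calc O₁.valuation (t : K) ^ (n + 1) = O₁.valuation (t : K) ^ n * O₁.valuation (t : K) := pow_succ _ _
      _ ≤ 1 * O₁.valuation (t : K) := by gcongr
      _ = O₁.valuation (t : K) := one_mul _

/-- **The values are archimedean with respect to `v₁ t`** (hypothesis `harch` of ✓ `exists_best_pthPowerApprox_of_derivation`). [folklore] -/
theorem exists_pow_le_valuation (O₁ : ValuationSubring K) (R : Subring K) (hRO₁ : R ≤ O₁.toSubring)
    (hloc : O₁.toSubring ≤ locAtCentre R O₁) [IsNoetherianRing R] (t : R) (ht : Prime t)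
    (hvt : O₁.valuation (t : K) < 1) (x : K) (hx0 : x ≠ 0) :
    ∃ n : ℕ, O₁.valuation (t : K) ^ n ≤ O₁.valuation x := by
  by_cases hxO : x ∈ O₁
  · obtain ⟨n, hn⟩ := exists_valuation_eq_pow O₁ R hRO₁ hloc t ht hvt x hxO hx0
    exact ⟨n, hn.symm.le⟩
  · refine ⟨0, ?_⟩
    rw [pow_zero]
    rw [← O₁.valuation_le_one_iff] at hxO
    exact (not_le.mp hxO).le

/-- **GLUE 1 — the best-approximation data inside the frame ring.**  `R ⊆ O₁ ⊆ locAtCentre R O₁` Noetherian, `t ∈ R` prime with `v₁ t < 1`;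
`g₀ ∈ R`; `a` a best `p`-th-power approximation of `g₀` for `v₁` in the INERT branch (`c ≠ 0`, `v₁ (c^p) = v₁ (g₀ − a^p)`, and
`(g₀ − a^p)/c^p` residually not a `p`-th power).  Then there are `w, a', u ∈ R` and `m : ℕ` with `v₁ w = 1`, `v₁ u = 1`,
`w^p g₀ − a'^p = t^{pm} u`, and `u` residually not a `p`-th power (`¬ v₁ (u − d^p) < 1` for `d ∈ O₁`). [folklore] -/
theorem exists_bestApprox_data_in_frame (p : ℕ) [hp : Fact p.Prime] (O₁ : ValuationSubring K) (R : Subring K)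
    (hRO₁ : R ≤ O₁.toSubring) (hloc : O₁.toSubring ≤ locAtCentre R O₁) [IsNoetherianRing R] (t : R) (ht : Prime t)
    (hvt : O₁.valuation (t : K) < 1) (g₀ : K) (hg₀ : g₀ ∈ R) (a c : K) (hc : c ≠ 0)
    (hvc : O₁.valuation (c ^ p) = O₁.valuation (g₀ - a ^ p))
    (hbest : ∀ b : K, O₁.valuation (g₀ - a ^ p) ≤ O₁.valuation (g₀ - b ^ p))
    (hres : ∀ d : K, d ∈ O₁ → ¬ O₁.valuation ((g₀ - a ^ p) / c ^ p - d ^ p) < 1) :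
    ∃ (w a' u : R) (m : ℕ), O₁.valuation (w : K) = 1 ∧ O₁.valuation (u : K) = 1 ∧
      (w : K) ^ p * g₀ - (a' : K) ^ p = (t : K) ^ (p * m) * (u : K) ∧
      ∀ d : K, d ∈ O₁ → ¬ O₁.valuation ((u : K) - d ^ p) < 1 := by
  have hp0 : p ≠ 0 := hp.out.ne_zero
  have hvle : ∀ r : R, O₁.valuation (r : K) ≤ 1 := fun r => (O₁.valuation_le_one_iff _).mpr (hRO₁ r.2)
  have ht0 : (t : K) ≠ 0 := fun h => ht.ne_zero (Subtype.ext h)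
  have hvt0 : 0 < O₁.valuation (t : K) := zero_lt_iff.mpr ((Valuation.ne_zero_iff _).mpr ht0)
  have hcp0 : c ^ p ≠ 0 := pow_ne_zero _ hc
  have hne : g₀ - a ^ p ≠ 0 := by
    intro h
    rw [h, map_zero] at hvc
    exact hcp0 ((Valuation.zero_iff _).mp hvc)
  -- `a ∈ O₁`
  have haO : a ∈ O₁ := by
    by_contra haO
    rw [← O₁.valuation_le_one_iff, not_le] at haO
    have hap : 1 < O₁.valuation (a ^ p) := by
      rw [map_pow]; exact one_lt_pow₀ haO hp0
    have hg₀1 : O₁.valuation g₀ ≤ 1 := hvle ⟨g₀, hg₀⟩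
    have h1 : O₁.valuation (g₀ - a ^ p) ≤ O₁.valuation g₀ := by
      have := hbest 0
      rwa [zero_pow hp0, sub_zero] at this
    have h2 : O₁.valuation (a ^ p) ≤ max (O₁.valuation (a ^ p - g₀)) (O₁.valuation g₀) := by
      have := Valuation.map_add O₁.valuation (a ^ p - g₀) g₀
      rwa [sub_add_cancel] at this
    rw [Valuation.map_sub_swap] at h2
    have h3 : max (O₁.valuation (g₀ - a ^ p)) (O₁.valuation g₀) ≤ 1 := max_le (h1.trans hg₀1) hg₀1
    exact absurd (hap.trans_le (h2.trans h3)) (lt_irrefl _)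
  -- `a = a₀ / w`
  obtain ⟨a₀, ha₀, w, hw, hvw, haw⟩ := (mem_locAtCentre_iff (B := R) (O := O₁)).mp (hloc haO)
  have hw0 : w ≠ 0 := ne_zero_of_valuation_eq_one hvw
  -- the remainder in `R`
  obtain ⟨r, hrdef⟩ : ∃ r : R, r = ⟨w, hw⟩ ^ p * ⟨g₀, hg₀⟩ - ⟨a₀, ha₀⟩ ^ p := ⟨_, rfl⟩
  have hrK0 : (r : K) = w ^ p * g₀ - a₀ ^ p := by rw [hrdef]; push_cast; ring
  have hrK : (r : K) = w ^ p * (g₀ - a ^ p) := by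
    rw [hrK0, haw, div_pow, mul_sub, mul_div_assoc', mul_div_cancel_left₀ _ (pow_ne_zero _ hw0)]
  have hr0 : r ≠ 0 := by
    intro h
    have : (r : K) = 0 := by rw [h]; rfl
    rw [hrK] at this
    rcases mul_eq_zero.mp this with h' | h'
    · exact pow_ne_zero _ hw0 h'
    · exact hne h'
  obtain ⟨n, e, hve, hre⟩ := exists_eq_pow_mul_of_prime O₁ R hRO₁ hloc t ht hvt r hr0
  -- `c ∈ O₁` and `v₁ c = (v₁ t)^m`
  have hvr : O₁.valuation (r : K) = O₁.valuation c ^ p := by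
    rw [hrK, map_mul, map_pow, hvw, one_pow, one_mul, ← hvc, map_pow]
  have hcO : c ∈ O₁ := by
    rw [← O₁.valuation_le_one_iff]
    by_contra hlt
    rw [not_le] at hlt
    have : 1 < O₁.valuation (r : K) := by rw [hvr]; exact one_lt_pow₀ hlt hp0
    exact absurd ((hvle r).trans_lt this) (lt_irrefl _)
  obtain ⟨m, hm⟩ := exists_valuation_eq_pow O₁ R hRO₁ hloc t ht hvt c hcO hc
  have hvr' : O₁.valuation (r : K) = O₁.valuation (t : K) ^ n := by
    have := congrArg (fun x : R => (x : K)) hre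
    simp only [Subring.coe_mul, Subring.coe_pow] at this
    rw [this, map_mul, map_pow, hve, mul_one]
  have hnm : n = p * m := by
    have heq : O₁.valuation (t : K) ^ n = O₁.valuation (t : K) ^ (p * m) := by
      rw [← hvr', hvr, hm, ← pow_mul, mul_comm]
    by_contra hne'
    rcases Nat.lt_or_gt_of_ne hne' with hlt | hlt
    · have := (pow_lt_pow_iff_right_of_lt_one₀ hvt0 hvt).mpr hlt
      rw [heq] at this; exact lt_irrefl _ this
    · have := (pow_lt_pow_iff_right_of_lt_one₀ hvt0 hvt).mpr hlt
      rw [heq] at this; exact lt_irrefl _ this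
  have hreK : (r : K) = (t : K) ^ (p * m) * (e : K) := by
    have := congrArg (fun x : R => (x : K)) hre
    push_cast at this
    rw [hnm] at this
    exact this
  refine ⟨⟨w, hw⟩, ⟨a₀, ha₀⟩, e, m, hvw, hve, ?_, ?_⟩
  · -- the factorisation
    change w ^ p * g₀ - a₀ ^ p = _
    rw [← hrK0, hreK]
  · -- `u = e = λ^p · u₀` with `λ = w c / t^m` an `O₁`-unit and `u₀ = (g₀ - a^p)/c^p`
    intro d hd
    have htm0 : (t : K) ^ m ≠ 0 := pow_ne_zero _ ht0
    obtain ⟨lam, hlam⟩ : ∃ lam : K, lam = w * c / (t : K) ^ m := ⟨_, rfl⟩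
    have hlam0 : lam ≠ 0 := by rw [hlam]; exact div_ne_zero (mul_ne_zero hw0 hc) htm0
    have hvlam : O₁.valuation lam = 1 := by
      rw [hlam, map_div₀, map_mul, hvw, one_mul, hm, map_pow, div_self (pow_ne_zero _ hvt0.ne')]
    have heK : (e : K) = lam ^ p * ((g₀ - a ^ p) / c ^ p) := by
      have h2 : (e : K) = (r : K) / (t : K) ^ (p * m) := by
        rw [hreK, mul_div_cancel_left₀ _ (pow_ne_zero _ ht0)]
      rw [h2, hrK, hlam, div_pow, mul_pow, ← pow_mul, mul_comm m p]
      field_simp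
    have hdlam : d / lam ∈ O₁ := by
      rw [← O₁.valuation_le_one_iff, map_div₀, hvlam, div_one, O₁.valuation_le_one_iff]; exact hd
    have hmdc : lam ^ p * (d / lam) ^ p = d ^ p := by
      rw [div_pow, mul_div_assoc', mul_div_cancel_left₀ _ (pow_ne_zero _ hlam0)]
    have hfac : (e : K) - d ^ p = lam ^ p * ((g₀ - a ^ p) / c ^ p - (d / lam) ^ p) := by
      rw [heK, mul_sub, hmdc]
    intro hlt
    apply hres (d / lam) hdlam
    rw [hfac, map_mul, map_pow, hvlam, one_pow, one_mul] at hlt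
    exact hlt

end Summit.ResolutionOfSingularities.ResolutionOfSingularities.Theorems.RadicialJung.CleanModels

end
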